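import Literature.Analysis.FluidPDE.LeiZhang2011HeatGaugeStream
import Literature.Analysis.FluidPDE.LeiZhang2011DuhamelCorrector
import Literature.Analysis.FluidPDE.LeiZhang2011RegularityUniform
import Literature.Analysis.FluidPDE.LeiZhang2011SwirlEquation
import Literature.Analysis.FluidPDE.LeiZhang2011Final
import Literature.Analysis.FluidPDE.VorticityCalculus
import Literature.Analysis.FunctionSpaces.BMOProofs
import Literature.Analysis.FunctionSpaces.BMOBoundedProofs
import HarnessLib

/-!
# Lei–Zhang 2011, Theorem 1.4 — the heat-flow gauge, IV: the swirl step, and Theorem 1.4 for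
# smooth data

Analysis/FluidPDE **proofs file** (theorems only: no definitions, no named facts, no `sorry`)
on the discharge path of `Literature.Analysis.FluidPDE.LeiZhang2011_regularity_bmoStream`
(Z. Lei, Q. S. Zhang, J. Funct. Anal. 261 (2011) = arXiv:1011.5066, **Theorem 1.4**).

* `exists_differentiable_stream_of_distributional` — **the gauge fix**: a bounded
  divergence-free `w ∈ C²(ℝ³; ℝ³)` with bounded `Dw`, `D²w` whose *distributional* stream
  function `g` (`∫ φ ⟪w, e⟫ = ∫ ⟪g × ∇φ, e⟫`, `φ ∈ C¹_c`) is locally integrable with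
  `‖g‖_{BMO} ≤ K` has a *differentiable* stream function `B = e^{Δ}g + ∫₀¹ e^{σΔ} curl w dσ`,
  `curl B = w` everywhere, `‖B‖_{BMO} ≤ K + 2‖curl‖ sup ‖Dw‖` (`curl_heatGauge`,
  `curl_duhamelCorrector`, `eBMOSeminormVec_heatGauge_le`, `L^∞ ⊂ BMO`).
* `swirlStepU_holds` — **the swirl step of the proof of Theorem 1.4** (hypothesis `hstep` of
  `LeiZhang2011RegularityUniform`): a continuous bounded weak ancient axisymmetric solution with
  bounded `Γ = r v^θ` and distributional `L^∞_t BMO_x` stream functions is swirl free — indeed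
  zero: its slices are `U(t) + γ(t) e₃` with `U(t)` smooth, all derivatives bounded uniformly in
  `t` (`exists_smooth_rep_swirl_equation_of_continuous`, KNSS 2009 §4), the gauge fix supplies
  differentiable `BMO` stream slices with a uniform bound, and **Theorem 1.2**
  (`LeiZhang2011_liouville_holds`, `LeiZhang2011Final`) gives `v ≡ 0`.
* Consequences, now **unconditional**: Theorem 1.4 in the classical frame
  (`LeiZhang2011_regularity_classical`, `…_classical_datum`, `LeiZhang2011_hasSmoothExtensionPast`),
  in the Leray–Hopf frame with `Γ` bounded on the slab (`LeiZhang2011_regularity_lerayHopf`,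
  `LeiZhang2011_regularity_bmoStream_of_swirlBound`), **Theorem 1.4 for smooth data**
  (`LeiZhang2011_regularity_smoothDatum`, `LeiZhang2011_regularity_bmoStream_smoothDatum`), and
  the named fact from the maximum principle for `Γ` along the weak solution alone
  (`LeiZhang2011_regularity_bmoStream_of_weakMaxPrinciple`; "by the assumption on initial value
  and the maximum principle", p. 12, the one sentence of the printed proof not carried out for
  rough Leray–Hopf data).

## References

* Z. Lei, Q. S. Zhang, J. Funct. Anal. 261 (2011) = arXiv:1011.5066: Thms. 1.2, 1.4, Rem. 1.5
  and §4 (arXiv pp. 4, 12–13). [LeiZhang2011]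
* G. Koch, N. Nadirashvili, G. Seregin, V. Šverák, Acta Math. 203 (2009), §4.
  [KochNadirashviliSereginSverak2009]
* H. Koch, D. Tataru, Adv. Math. 157 (2001), §4. [KochTataruAdvMath2001]
-/

noncomputable section

open MeasureTheory Set Function Filter Topology Metric
open scoped InnerProductSpace RealInnerProductSpace NNReal ENNReal

namespace Literature.Analysis.FluidPDE

open Literature.Analysis.FunctionSpaces

/-! ### `BMO` bookkeeping -/

/-- Subadditivity of the vector `BMO` seminorm. [folklore] -/
theorem eBMOSeminormVec_add_le {Φ Ψ : EuclideanSpace ℝ (Fin 3) → EuclideanSpace ℝ (Fin 3)}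
    (hΦ : LocallyIntegrable Φ volume) (hΨ : LocallyIntegrable Ψ volume) :
    eBMOSeminormVec (fun x => Φ x + Ψ x) ≤ eBMOSeminormVec Φ + eBMOSeminormVec Ψ := by
  refine iSup₂_le fun v hv => ?_
  have h : (fun x => ⟪Φ x + Ψ x, v⟫) = (fun x => ⟪Φ x, v⟫) + fun x => ⟪Ψ x, v⟫ :=
    funext fun x => by simp [inner_add_left]
  rw [h]
  refine (eBMOSeminorm_add_le_holds (locallyIntegrable_inner_const hΦ v)
    (locallyIntegrable_inner_const hΨ v)).trans ?_
  exact add_le_add (le_iSup₂_of_le v hv le_rfl) (le_iSup₂_of_le v hv le_rfl)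

/-- `L^∞ ⊂ BMO` for vector fields: `‖A‖_{BMO} ≤ 2 sup ‖A‖`. [folklore] -/
theorem eBMOSeminormVec_le_of_norm_le {A : EuclideanSpace ℝ (Fin 3) → EuclideanSpace ℝ (Fin 3)}
    {C : ℝ} (hC : ∀ x, ‖A x‖ ≤ C) : eBMOSeminormVec A ≤ 2 * ENNReal.ofReal C := by
  refine iSup₂_le fun v hv => ?_
  refine (eBMOSeminorm_le_two_mul_eLpNorm_top_holds (fun x => ⟪A x, v⟫) volume).trans ?_
  gcongr
  rw [eLpNorm_exponent_top]
  refine eLpNormEssSup_le_of_ae_bound (Eventually.of_forall fun x => ?_)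
  calc ‖⟪A x, v⟫‖ ≤ ‖A x‖ * ‖v‖ := norm_inner_le_norm _ _
    _ ≤ C * 1 := mul_le_mul (hC x) hv (norm_nonneg _) ((norm_nonneg _).trans (hC x))
    _ = C := mul_one C

/-! ### The gauge fix -/

/-- **The heat-flow gauge.** Let `w ∈ C²(ℝ³; ℝ³)` be divergence free with `w`, `Dw`, `D²w`
bounded, and let `g` be a locally integrable *distributional* stream function of `w`
(`∫ φ ⟪w, e⟫ = ∫ ⟪g × ∇φ, e⟫` for all `φ ∈ C¹_c`, `e`) with `‖g‖_{BMO} ≤ K`. Then `w` has a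
*differentiable* stream function `B` with `curl B = w` everywhere and
`‖B‖_{BMO} ≤ K + 2 ‖curl‖ sup ‖Dw‖`: `B = e^{Δ}g + ∫₀¹ e^{σΔ}(curl w) dσ`
(`curl e^{Δ}g = e^{Δ}w` by `curl_heatGauge`, `curl ∫₀¹ e^{σΔ} curl w dσ = w − e^{Δ}w` by
`curl_duhamelCorrector`, `‖e^{Δ}g‖_{BMO} ≤ ‖g‖_{BMO}`, and the corrector is bounded by
`‖curl‖ sup ‖Dw‖`). [folklore] -/
theorem exists_differentiable_stream_of_distributional
    {w g : EuclideanSpace ℝ (Fin 3) → EuclideanSpace ℝ (Fin 3)} (hw : ContDiff ℝ 2 w)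
    (hdiv : VectorCalculus.IsDivFree w) {C₀ C₁ C₂ : ℝ} (h0 : ∀ z, ‖w z‖ ≤ C₀)
    (h1 : ∀ z, ‖fderiv ℝ w z‖ ≤ C₁) (h2 : ∀ z, ‖fderiv ℝ (fderiv ℝ w) z‖ ≤ C₂)
    (hg : LocallyIntegrable g volume) {K : ℝ≥0} (hK : eBMOSeminormVec g ≤ K)
    (hid : ∀ (φ : EuclideanSpace ℝ (Fin 3) → ℝ) (e : EuclideanSpace ℝ (Fin 3)),
      ContDiff ℝ 1 φ → HasCompactSupport φ →
        ∫ x, φ x * ⟪w x, e⟫ = ∫ x, ⟪cross (g x) (gradient φ x), e⟫) :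
    ∃ B : EuclideanSpace ℝ (Fin 3) → EuclideanSpace ℝ (Fin 3),
      Differentiable ℝ B ∧ (∀ y, curl B y = w y) ∧
        eBMOSeminormVec B ≤ K + 2 * ENNReal.ofReal (‖curlCLM‖ * C₁) := by
  set G : EuclideanSpace ℝ (Fin 3) → EuclideanSpace ℝ (Fin 3) := fun y =>
    (WithLp.toLp 2 fun m : Fin 3 => BMOInv.heatExtension (fun z => g z m) 1 y :
      EuclideanSpace ℝ (Fin 3)) with hG
  set A : EuclideanSpace ℝ (Fin 3) → EuclideanSpace ℝ (Fin 3) := fun y =>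
    ∫ σ in Ioo (0 : ℝ) 1, UnboundedOperators.heatExtension (curl w) σ y with hA
  obtain ⟨hGd, -⟩ := differentiable_heatGauge hg hK one_pos
  have hGbmo := eBMOSeminormVec_heatGauge_le hg hK one_pos
  have hGcurl := fun y => curl_heatGauge hg hK hw.continuous h0 hid one_pos y
  obtain ⟨hAd, hAb, hAcurl⟩ := curl_duhamelCorrector hw hdiv h0 h1 h2
  refine ⟨fun y => G y + A y, hGd.add hAd, fun y => ?_, ?_⟩
  · rw [curl_add (hGd y) (hAd y), hGcurl y, hAcurl y]
    abel
  · calc eBMOSeminormVec (fun y => G y + A y) ≤ eBMOSeminormVec G + eBMOSeminormVec A :=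
          eBMOSeminormVec_add_le hGd.continuous.locallyIntegrable hAd.continuous.locallyIntegrable
      _ ≤ K + 2 * ENNReal.ofReal (‖curlCLM‖ * C₁) :=
          add_le_add hGbmo (eBMOSeminormVec_le_of_norm_le hAb)

/-! ### The swirl step -/

/-- **The swirl step of the proof of Theorem 1.4 (Lei–Zhang 2011, §4, Case 1: "by Theorem 1.1
… `v^θ ≡ 0`"), in the uniform form `hstep` of `LeiZhang2011RegularityUniform` — proved.** Let `v`
be a bounded weak solution of Navier–Stokes (`ν = 1`) on `ℝ³ × (−∞, 0)`, jointly continuous, with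
axisymmetric slices, `|Γ| = |r v^θ| ≤ C`, and for every `t < 0` a locally integrable
distributional stream function `B_t` with `‖B_t‖_{BMO} ≤ K'`. Then `v` is swirl free — in fact
`v ≡ 0`: by KNSS 2009 §4 (`exists_smooth_rep_swirl_equation_of_continuous`)
`v(t) = U(t) + γ(t) e₃` with `U(t)` smooth, divergence free, `‖∇ᵏU‖ ≤ C_k` uniformly in `t`;
the gauge fix (`exists_differentiable_stream_of_distributional`) turns `B_t` into a
differentiable stream slice with `‖·‖_{BMO} ≤ K' + 2‖curl‖C₁`, uniformly in `t`; and
**Theorem 1.2** (`LeiZhang2011_liouville_holds`) gives `v(t) = 0` a.e. for a.e.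
`t`, hence everywhere by continuity.
[cite: LeiZhang2011, Thm. 1.2 and proof of Thm. 1.4, Case 1 (arXiv pp. 4, 12–13)] -/
theorem swirlStepU_holds :
    ∀ (v : ℝ → EuclideanSpace ℝ (Fin 3) → EuclideanSpace ℝ (Fin 3)) (C : ℝ) (K' : ℝ≥0),
      IsBoundedWeakNSSolutionOn (Iio 0) isOpen_Iio 1 v → Continuous (uncurry v) →
      (∀ t < 0, IsAxisymmetric (v t)) → (∀ t < 0, ∀ x, |swirl (v t) x| ≤ C) →
      (∀ t < 0, ∃ Bt : EuclideanSpace ℝ (Fin 3) → EuclideanSpace ℝ (Fin 3),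
        LocallyIntegrable Bt volume ∧ eBMOSeminormVec Bt ≤ K' ∧
        ∀ (φ : EuclideanSpace ℝ (Fin 3) → ℝ) (e : EuclideanSpace ℝ (Fin 3)),
          ContDiff ℝ 1 φ → HasCompactSupport φ →
            ∫ x, φ x * ⟪v t x, e⟫ = ∫ x, ⟪cross (Bt x) (gradient φ x), e⟫) →
      ∀ t < 0, HasNoSwirl (v t) := by
  intro v C K' hweak hcont haxi hΓ hB
  -- the smooth representative of KNSS 2009, §4
  obtain ⟨U, γ, -, -, hrep, hsm, hdivU, -, hbd, -, -, -⟩ :=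
    exists_smooth_rep_swirl_equation_of_continuous hweak hcont haxi
  obtain ⟨Cv, hCv⟩ := hweak.isBoundedOn
  obtain ⟨C1, hC1⟩ := hbd 1
  obtain ⟨C2, hC2⟩ := hbd 2
  have hvt : ∀ t < 0, v t = fun x => U t x + γ t • eZ := fun t ht => funext fun x => hrep t ht x
  have hsmooth : ∀ t < 0, ContDiff ℝ 2 (v t) := fun t ht => by
    rw [hvt t ht]
    exact (contDiff_infty.1 (hsm t ht) 2).add contDiff_const
  have hfd : ∀ t < 0, fderiv ℝ (v t) = fderiv ℝ (U t) := fun t ht => by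
    rw [hvt t ht]
    funext x
    exact fderiv_add_const _
  have hdivv : ∀ t < 0, VectorCalculus.IsDivFree (v t) := fun t ht x => by
    unfold VectorCalculus.divergence
    rw [hfd t ht]
    exact hdivU t ht x
  have hb1 : ∀ t < 0, ∀ x, ‖fderiv ℝ (v t) x‖ ≤ C1 := fun t ht x => by
    rw [hfd t ht, ← norm_iteratedFDeriv_one]
    exact hC1 t ht x
  have hb2 : ∀ t < 0, ∀ x, ‖fderiv ℝ (fderiv ℝ (v t)) x‖ ≤ C2 := fun t ht x => by
    rw [hfd t ht, ← norm_iteratedFDeriv_one, norm_iteratedFDeriv_fderiv]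
    exact hC2 t ht x
  -- the gauge fix, slice by slice, with a bound uniform in `t`
  have hgauge : ∀ t < 0, ∃ B : EuclideanSpace ℝ (Fin 3) → EuclideanSpace ℝ (Fin 3),
      Differentiable ℝ B ∧ (∀ y, curl B y = v t y) ∧
        eBMOSeminormVec B ≤ K' + 2 * ENNReal.ofReal (‖curlCLM‖ * C1) := fun t ht => by
    obtain ⟨Bt, hBi, hBK, hid⟩ := hB t ht
    exact exists_differentiable_stream_of_distributional (hsmooth t ht) (hdivv t ht)
      (hCv t ht) (hb1 t ht) (hb2 t ht) hBi hBK hid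
  choose! Bf hBf using hgauge
  set Cst : ℝ≥0 := K' + 2 * Real.toNNReal (‖curlCLM‖ * C1) with hCst
  have hCst' : (Cst : ℝ≥0∞) = K' + 2 * ENNReal.ofReal (‖curlCLM‖ * C1) := by
    rw [hCst, ENNReal.coe_add, ENNReal.coe_mul, ENNReal.ofReal]
    norm_num
  have hstream : HasBMOStreamFunctionOn (Iio 0) v Bf Cst := fun t ht => by
    obtain ⟨hd, hc, hbmo⟩ := hBf t ht
    exact ⟨hd, Eventually.of_forall hc, hCst' ▸ hbmo⟩
  -- Theorem 1.2 and continuity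
  have hae := LeiZhang2011_liouville_holds.of_pointwise hweak haxi hΓ hstream
  have hzero := forall_eq_zero_of_ae_slice_eq_zero hcont hae
  intro t ht x
  simp [swirl, hzero t ht.le x]

/-! ### Theorem 1.4, unconditional forms -/

section Consequences

variable {T : ℝ}

/-- **Lei–Zhang 2011, Theorem 1.4 (classical frame).** A classical solution of the unforced
Navier–Stokes system (`ν = 1`) on `(0, T) × ℝ³`, bounded on every earlier slab, with
axisymmetric slices, `|Γ| ≤ C₁` and a stream function with `BMO` slices, is bounded on
`(0, T) × ℝ³` (`LeiZhang2011_regularity_classical_of_swirlStepU` and `swirlStepU_holds`).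
[cite: LeiZhang2011, Thm. 1.4 and proof §4 (arXiv pp. 12–13)] -/
theorem LeiZhang2011_regularity_classical
    {u : ℝ → EuclideanSpace ℝ (Fin 3) → EuclideanSpace ℝ (Fin 3)}
    {p : ℝ → EuclideanSpace ℝ (Fin 3) → ℝ} (hT : 0 < T)
    (h : IsClassicalNSSolutionOn (Ioo 0 T) 1 0 u p)
    (hbdd : ∀ T' < T, ∃ M : ℝ, ∀ t ∈ Ioo 0 T', ∀ x, ‖u t x‖ ≤ M)
    (haxi : ∀ t ∈ Ioo 0 T, IsAxisymmetric (u t))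
    (hΓ : ∃ C₁ : ℝ, ∀ t ∈ Ioo 0 T, ∀ x, |swirl (u t) x| ≤ C₁)
    (hB : ∃ (B : ℝ → EuclideanSpace ℝ (Fin 3) → EuclideanSpace ℝ (Fin 3)) (K : ℝ≥0),
      HasBMOStreamFunctionOn (Ioo 0 T) u B K) :
    ∃ M : ℝ, ∀ t ∈ Ioo 0 T, ∀ x, ‖u t x‖ ≤ M :=
  LeiZhang2011_regularity_classical_of_swirlStepU swirlStepU_holds hT h hbdd haxi hΓ hB

/-- **Lei–Zhang 2011, Theorem 1.4 (classical frame, datum form)**: for a classical solution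
on `[0, T) × ℝ³` the hypothesis on `Γ` is needed at `t = 0` only (maximum principle,
`abs_swirl_le_of_classical`). [cite: LeiZhang2011, Thm. 1.4 and proof §4 (arXiv pp. 12–13)] -/
theorem LeiZhang2011_regularity_classical_datum
    {u : ℝ → EuclideanSpace ℝ (Fin 3) → EuclideanSpace ℝ (Fin 3)}
    {p : ℝ → EuclideanSpace ℝ (Fin 3) → ℝ} (hT : 0 < T)
    (h : IsClassicalNSSolutionOn (Ico 0 T) 1 0 u p)
    (hbdd : ∀ T' < T, ∃ M : ℝ, ∀ t ∈ Icc 0 T', ∀ x, ‖u t x‖ ≤ M)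
    (haxi : ∀ t ∈ Ico 0 T, IsAxisymmetric (u t))
    (hΓ₀ : ∃ C : ℝ, ∀ x, |swirl (u 0) x| ≤ C)
    (hB : ∃ (B : ℝ → EuclideanSpace ℝ (Fin 3) → EuclideanSpace ℝ (Fin 3)) (K : ℝ≥0),
      HasBMOStreamFunctionOn (Ioo 0 T) u B K) :
    ∃ M : ℝ, ∀ t ∈ Ioo 0 T, ∀ x, ‖u t x‖ ≤ M :=
  LeiZhang2011_regularity_classical_datum_of_swirlStepU swirlStepU_holds hT h hbdd haxi hΓ₀ hB

/-- **Lei–Zhang 2011, Theorem 1.4 (continuation form)**: a classical Leray–Hopf solution on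
`[0, T)` with axisymmetric slices, `|Γ(·, 0)| ≤ C` and a stream function with `BMO` slices
extends smoothly past `T`.
[cite: LeiZhang2011, Thm. 1.4, Rem. 1.5 and proof §4 (arXiv pp. 4, 12–13)] -/
theorem LeiZhang2011_hasSmoothExtensionPast
    {u : ℝ → EuclideanSpace ℝ (Fin 3) → EuclideanSpace ℝ (Fin 3)}
    {p : ℝ → EuclideanSpace ℝ (Fin 3) → ℝ} (hT : 0 < T)
    (h : IsClassicalNSSolutionOn (Ico 0 T) 1 0 u p) (hLH : IsLerayHopfOn T 1 0 (u 0) u)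
    (hbdd : ∀ T' < T, ∃ M : ℝ, ∀ t ∈ Icc 0 T', ∀ x, ‖u t x‖ ≤ M)
    (haxi : ∀ t ∈ Ico 0 T, IsAxisymmetric (u t))
    (hΓ₀ : ∃ C : ℝ, ∀ x, |swirl (u 0) x| ≤ C)
    (hB : ∃ (B : ℝ → EuclideanSpace ℝ (Fin 3) → EuclideanSpace ℝ (Fin 3)) (K : ℝ≥0),
      HasBMOStreamFunctionOn (Ioo 0 T) u B K) :
    HasSmoothExtensionPast 1 0 u T :=
  LeiZhang2011_hasSmoothExtensionPast_of_swirlStepU swirlStepU_holds hT h hLH hbdd haxi hΓ₀ hB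

/-- **Lei–Zhang 2011, Theorem 1.4 for Leray–Hopf weak solutions with `Γ` bounded on the
slab**: a classical representative on `(0, T]`.
[cite: LeiZhang2011, Thm. 1.4 and proof §4 (arXiv pp. 4, 12–13)] -/
theorem LeiZhang2011_regularity_lerayHopf
    {u₀ : EuclideanSpace ℝ (Fin 3) → EuclideanSpace ℝ (Fin 3)}
    {u : ℝ → EuclideanSpace ℝ (Fin 3) → EuclideanSpace ℝ (Fin 3)} (hT : 0 < T)
    (hLH : IsLerayHopfOn T 1 0 u₀ u) (haxi : ∀ t ∈ Ioo 0 T, IsAxisymmetric (u t))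
    (hΓ : ∃ C₁ : ℝ, ∀ t ∈ Ioo 0 T, ∀ᵐ x ∂volume, |swirl (u t) x| ≤ C₁)
    (hB : ∃ (B : ℝ → EuclideanSpace ℝ (Fin 3) → EuclideanSpace ℝ (Fin 3)) (K : ℝ≥0),
      HasBMOStreamFunctionOn (Ioo 0 T) u B K) :
    ∃ (V : ℝ → EuclideanSpace ℝ (Fin 3) → EuclideanSpace ℝ (Fin 3))
      (P : ℝ → EuclideanSpace ℝ (Fin 3) → ℝ),
      IsClassicalNSSolutionOn (Ioc 0 T) 1 0 V P ∧ ∀ t ∈ Ioc 0 T, u t =ᵐ[volume] V t :=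
  LeiZhang2011_regularity_lerayHopf_of_swirlStepU swirlStepU_holds hT hLH haxi hΓ hB

/-- **Lei–Zhang 2011, Theorem 1.4 in the shape of the named fact, with the bound on `Γ`
assumed on the slab** (a.e. on each slice of `(0, T)`) instead of at the initial time; the
suitability hypothesis of the named fact is not needed. The only distance to the named fact
`LeiZhang2011_regularity_bmoStream` is the sentence "by the assumption on initial value and the
maximum principle" (p. 12) for rough Leray–Hopf data.
[cite: LeiZhang2011, Thm. 1.4 (arXiv p. 4) and proof §4 (pp. 12–13)] -/
theorem LeiZhang2011_regularity_bmoStream_of_swirlBound (hT : 0 < T)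
    {v : ℝ → EuclideanSpace ℝ (Fin 3) → EuclideanSpace ℝ (Fin 3)}
    (hLH : IsLerayHopfOn T 1 0 (v 0) v) (haxi : ∀ t ∈ Ioo 0 T, IsAxisymmetric (v t))
    (hΓ : ∃ C : ℝ, ∀ t ∈ Ioo 0 T, ∀ᵐ x ∂volume, |swirl (v t) x| ≤ C)
    (hB : ∃ (B : ℝ → EuclideanSpace ℝ (Fin 3) → EuclideanSpace ℝ (Fin 3)) (C : ℝ≥0),
      HasBMOStreamFunctionOn (Ioo 0 T) v B C) :
    ∃ w : ℝ → EuclideanSpace ℝ (Fin 3) → EuclideanSpace ℝ (Fin 3),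
      IsSmoothSpaceTimeOn (Ioc 0 T) w ∧
        uncurry v =ᵐ[volume.restrict (Ioo 0 T ×ˢ univ)] uncurry w :=
  LeiZhang2011_regularity_bmoStream_of_swirlStepU_of_swirlBound swirlStepU_holds hT hLH haxi hΓ hB

/-- **Lei–Zhang 2011, Theorem 1.4 for Leray–Hopf solutions from smooth data.** Let `v` be a
Leray–Hopf weak solution of the unforced Navier–Stokes system (`ν = 1`) on `ℝ³ × [0, T)` from a
smooth divergence-free datum `v 0` with all derivatives in `L²`, with axisymmetric slices,
`|r v^θ(·, 0)| ≤ C`, and a stream function with `BMO` slices on `(0, T)`. Then `v` has a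
classical representative `(V, P)` on `[0, T] × ℝ³` with `V 0 = v 0`.
[cite: LeiZhang2011, Thm. 1.4, Rem. 1.5 and proof §4 (arXiv pp. 4, 12–13)] -/
theorem LeiZhang2011_regularity_smoothDatum (hT : 0 < T)
    {v : ℝ → EuclideanSpace ℝ (Fin 3) → EuclideanSpace ℝ (Fin 3)}
    (hLH : IsLerayHopfOn T 1 0 (v 0) v)
    (h0 : ContDiff ℝ (⊤ : ℕ∞) (v 0)) (h0div : VectorCalculus.IsDivFree (v 0))
    (h0sob : ∀ n : ℕ, ∫⁻ x, ‖iteratedFDeriv ℝ n (v 0) x‖ₑ ^ 2 < ⊤)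
    (haxi : ∀ t ∈ Ioo 0 T, IsAxisymmetric (v t)) (hΓ₀ : ∃ C : ℝ, ∀ x, |swirl (v 0) x| ≤ C)
    (hB : ∃ (B : ℝ → EuclideanSpace ℝ (Fin 3) → EuclideanSpace ℝ (Fin 3)) (K : ℝ≥0),
      HasBMOStreamFunctionOn (Ioo 0 T) v B K) :
    ∃ (V : ℝ → EuclideanSpace ℝ (Fin 3) → EuclideanSpace ℝ (Fin 3))
      (P : ℝ → EuclideanSpace ℝ (Fin 3) → ℝ),
      IsClassicalNSSolutionOn (Icc 0 T) 1 0 V P ∧ V 0 = v 0 ∧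
        ∀ t ∈ Ico 0 T, v t =ᵐ[volume] V t :=
  LeiZhang2011_regularity_smoothDatum_of_swirlStepU swirlStepU_holds hT hLH h0 h0div h0sob haxi
    hΓ₀ hB

/-- **Lei–Zhang 2011, Theorem 1.4 in the shape of the named fact, for smooth data** (all
derivatives of `v 0` in `L²`; the datum of a Leray–Hopf solution is weakly, hence classically,
divergence free; suitability is not needed).
[cite: LeiZhang2011, Thm. 1.4, Rem. 1.5 and proof §4 (arXiv pp. 4, 12–13)] -/
theorem LeiZhang2011_regularity_bmoStream_smoothDatum (hT : 0 < T)
    {v : ℝ → EuclideanSpace ℝ (Fin 3) → EuclideanSpace ℝ (Fin 3)}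
    (hLH : IsLerayHopfOn T 1 0 (v 0) v) (h0 : ContDiff ℝ (⊤ : ℕ∞) (v 0))
    (h0sob : ∀ n : ℕ, ∫⁻ x, ‖iteratedFDeriv ℝ n (v 0) x‖ₑ ^ 2 < ⊤)
    (haxi : ∀ t ∈ Ioo 0 T, IsAxisymmetric (v t)) (hΓ₀ : ∃ C : ℝ, ∀ x, |swirl (v 0) x| ≤ C)
    (hB : ∃ (B : ℝ → EuclideanSpace ℝ (Fin 3) → EuclideanSpace ℝ (Fin 3)) (K : ℝ≥0),
      HasBMOStreamFunctionOn (Ioo 0 T) v B K) :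
    ∃ w : ℝ → EuclideanSpace ℝ (Fin 3) → EuclideanSpace ℝ (Fin 3),
      IsSmoothSpaceTimeOn (Ioc 0 T) w ∧
        uncurry v =ᵐ[volume.restrict (Ioo 0 T ×ˢ univ)] uncurry w :=
  have h0div : VectorCalculus.IsDivFree (v 0) :=
    (hLH.isWeaklyDivFree_datum hT).isDivFree_of_contDiff (h0.of_le (by exact_mod_cast le_top))
  LeiZhang2011_regularity_bmoStream_smoothDatum_of_swirlStepU swirlStepU_holds hT hLH h0 h0div
    h0sob haxi hΓ₀ hB

/-- **Lei–Zhang 2011, Theorem 1.4 — the named fact `LeiZhang2011_regularity_bmoStream` from the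
maximum principle for `Γ` along the weak solution alone.** The remaining hypothesis is the
sentence "By the assumption on initial value and the maximum principle" of the printed proof
(p. 12) for the suitable Leray–Hopf solutions of the statement: `|r v^θ(·, 0)| ≤ C` propagates to
`|r v^θ(t, ·)| ≤ C'` a.e. for `0 < t < T` (proved in the tree for classical solutions,
`abs_swirl_le_of_classical`, whence the smooth-data theorem above is unconditional).
[cite: LeiZhang2011, Thm. 1.4 (arXiv p. 4) and proof §4 (pp. 12–13)] -/
theorem LeiZhang2011_regularity_bmoStream_of_weakMaxPrinciple
    (hmax : ∀ (T : ℝ), 0 < T →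
      ∀ (v : ℝ → EuclideanSpace ℝ (Fin 3) → EuclideanSpace ℝ (Fin 3))
        (p : ℝ → EuclideanSpace ℝ (Fin 3) → ℝ),
        IsSuitableWeakSolutionOn (slab (EuclideanSpace ℝ (Fin 3)) (Ioo 0 T) isOpen_Ioo) 1 0 v p →
        IsLerayHopfOn T 1 0 (v 0) v → (∀ t ∈ Ioo 0 T, IsAxisymmetric (v t)) →
        (∃ C : ℝ, ∀ x, |swirl (v 0) x| ≤ C) →
          ∃ C : ℝ, ∀ t ∈ Ioo 0 T, ∀ᵐ x ∂volume, |swirl (v t) x| ≤ C) :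
    LeiZhang2011_regularity_bmoStream :=
  LeiZhang2011_regularity_bmoStream_of_swirlStepU_of_weakMaxPrinciple swirlStepU_holds hmax

end Consequences

end Literature.Analysis.FluidPDE
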